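import Mathlib
import Literature.Probability.FitznerVanDerHofstad2017.NobleNSumSlices
import Summits.Ventures.LatticeQCDFlow.Scoring.CalibrationTruths
import Summits.Ventures.LatticeQCDFlow.Scoring.FejerPairSums
import Summits.Ventures.LatticeQCDFlow.Scoring.BartlettKernel
import Summits.Ventures.LatticeQCDFlow.Scoring.MadrasSokalErrorFormula
import Summits.Ventures.LatticeQCDFlow.Scoring.MadrasSokalRatioVariance
import HarnessLib

/-!
# The second-order term of the Madras–Sokal formula: `V(W) − 4 τ_int² W → −Σ_{u≥1} (u+1) K(u)` under a first moment of `K`, non-positive for `ρ ≥ 0`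

HONEST FRAMING: exact (Metropolis-corrected) sampling algorithms for lattice gauge theory;
figures of merit are autocorrelation/cost numbers at stated couplings and volumes; no
continuum-physics claim.

Venture `LatticeQCDFlow` (cell pub-lqcd), sub-topic `Scoring`; FANOUT row 16 (`su2-base`), GEN-6.
NEW WORK of the cell over this packet (`FejerPairSums`, `BartlettKernel`, `MadrasSokalErrorFormula`,
`MadrasSokalRatioVariance`) and the Literature's antidiagonal regrouping
`Literature.Probability.FitznerVanDerHofstad2017.NobleNSums.tsum_sum_antidiagonal` (folklore).  Nothing is
cited as a fact.  Printed counterparts, NAMED ONLY: Madras–Sokal 1988 App. C (the `+2` of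
`2(2W+1)`); Wolff 2004 eq. (42) (`−4τ³`).

Seventh file of the ERROR-OF-THE-ERROR packet.  `MadrasSokalErrorFormula` proved the LEADING order
`V(W)/W → 4τ²`; the printed bar carries a `+2τ²` beyond it.  Here the true constant of the Gaussian
model is identified, under a first moment of the kernel `K = acfConv ρ̄`
(`Σ_{t≥0} (t+1)|K(t+1)| < ∞`): with `V(W) = Σ_{s,t<W} K(t−s) + Σ_{s,t<W} K(s+t+2)`,

* `tendsto_sum_range_sum_range` — square partial sums of a summable `ℕ × ℕ` family converge to
  its sum (`range W ×ˢ range W → atTop`); `summable_antidiag_of_moment`, `tsum_antidiag_eq` — the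
  exchange family `(s,t) ↦ K(s+t+2)` is summable with sum `Σ_{v≥0} (v+1) K(v+2)` (antidiagonals);
* **`tendsto_diag_sub`** — the diagonal (Fejér) part: `Σ_{s,t<W} K(t−s) − W Σ_ℤ K →
  −2 Σ_{t≥0} (t+1) K(t+1)` (the Fejér defect; the `W ×` tail term is killed by the first moment);
* `windowConst ρ = −Σ_{t≥0} (t+2) K(t+1)` (`= −Σ_{u≥1} (u+1) K(u)`) and
  **`tendsto_tauHatAVar_sub_lin`** — `V(W) − 4 τ_int² W → windowConst ρ` as `W → ∞`; hence with
  `MadrasSokalRatioVariance.tendsto_tauHatRatioAVar_sub`: **`tendsto_tauHatRatioAVar_sub_lin`** —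
  `R(W) − 4 τ_int² W → windowConst ρ + ratioLimit ρ` for the (linearised) ratio estimator;
* signs: **`windowConst_le`** — for `ρ ≥ 0`, `windowConst ρ ≤ −(4τ² − K(0))` (drop the weights
  `t+2 ≥ 2`); `windowConst_le'` — for `0 ≤ ρ ≤ 1`, `≤ −2τ(2τ−1) ≤ 0`: the Gaussian-model constant
  is NEGATIVE where the printed one is `+2τ²`, i.e. `(4W+2)τ²` over-covers by `≥ 2τ² + 2τ(2τ−1)
  = 4τ² − 2τ… ` precisely `V(W) ≤ (4W+2)τ² − (6τ² − 2τ) + o(1)`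
  (`eventually_tauHatAVar_lt_printed_sub`).

NOT CLAIMED: the rate in `W` of these limits; the finite window `W = cτ`; the delta-method
remainder; non-Gaussian data; that the first-moment hypothesis on `K` follows from one on `ρ` (it
does, `Σ u|K(u)| ≤ 2‖ρ̄‖₁ Σ|m||ρ̄(m)|`, not typed here — on set C-1 it is checked directly in
`MadrasSokalWindowConstantGeometric.lean`).
-/

noncomputable section

open Finset Filter Topology

namespace Summit.Ventures.LatticeQCDFlow.Scoring

/-! ## Square partial sums of a summable `ℕ × ℕ` family -/

/-- The squares `range W ×ˢ range W` exhaust `Finset (ℕ × ℕ)`. -/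
theorem tendsto_range_prod_range_atTop :
    Tendsto (fun W : ℕ => range W ×ˢ range W) atTop atTop := by
  refine Monotone.tendsto_atTop_atTop (fun a b hab => product_subset_product (range_mono hab)
    (range_mono hab)) fun s => ?_
  refine ⟨s.sup (fun p => max p.1 p.2) + 1, fun p hp => ?_⟩
  have h1 : max p.1 p.2 ≤ s.sup (fun p => max p.1 p.2) :=
    Finset.le_sup (f := fun p : ℕ × ℕ => max p.1 p.2) hp
  simp only [mem_product, mem_range]
  omega

/-- Square partial sums of a summable `ℕ × ℕ` family converge to its sum. -/
theorem tendsto_sum_range_sum_range {F : ℕ × ℕ → ℝ} (hF : Summable F) :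
    Tendsto (fun W : ℕ => ∑ s ∈ range W, ∑ t ∈ range W, F (s, t)) atTop (𝓝 (∑' p, F p)) := by
  have := hF.hasSum.comp tendsto_range_prod_range_atTop
  refine this.congr fun W => ?_
  simp only [Function.comp_apply, sum_product]

/-- A family constant on antidiagonals, `(s,t) ↦ κ(s+t+2)`, is summable on `ℕ × ℕ` as soon as
`Σ_v (v+1)|κ(v+2)| < ∞`. -/
theorem summable_antidiag_of_moment {κ : ℕ → ℝ}
    (h : Summable fun v : ℕ => ((v : ℝ) + 1) * |κ (v + 2)|) :
    Summable fun p : ℕ × ℕ => κ (p.1 + p.2 + 2) := by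
  refine Summable.of_norm ?_
  have key : Summable ((fun p : ℕ × ℕ => ‖κ (p.1 + p.2 + 2)‖) ∘
      (HasAntidiagonal.sigmaAntidiagonalEquivProd (A := ℕ))) := by
    refine (summable_sigma_of_nonneg (f := (fun p : ℕ × ℕ => ‖κ (p.1 + p.2 + 2)‖) ∘
      (HasAntidiagonal.sigmaAntidiagonalEquivProd (A := ℕ))) fun _ => norm_nonneg _).mpr
      ⟨fun v => (hasSum_fintype _).summable, ?_⟩
    refine h.congr fun v => ?_
    rw [tsum_fintype]
    have hconst : ∀ q : (antidiagonal v : Finset (ℕ × ℕ)),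
        ((fun p : ℕ × ℕ => ‖κ (p.1 + p.2 + 2)‖) ∘
          (HasAntidiagonal.sigmaAntidiagonalEquivProd (A := ℕ))) ⟨v, q⟩ = |κ (v + 2)| := by
      intro q
      have hq := mem_antidiagonal.mp q.2
      simp only [Function.comp_apply, HasAntidiagonal.sigmaAntidiagonalEquivProd, Equiv.coe_fn_mk,
        Real.norm_eq_abs]
      rw [hq]
    simp only [hconst, sum_const, card_univ, Fintype.card_coe, Nat.card_antidiagonal,
      nsmul_eq_mul, Nat.cast_add, Nat.cast_one]
  exact (Equiv.summable_iff _).mp key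

/-- Its sum, regrouped by antidiagonals: `Σ_{(s,t)} κ(s+t+2) = Σ_v (v+1) κ(v+2)`. -/
theorem tsum_antidiag_eq {κ : ℕ → ℝ} (h : Summable fun v : ℕ => ((v : ℝ) + 1) * |κ (v + 2)|) :
    ∑' p : ℕ × ℕ, κ (p.1 + p.2 + 2) = ∑' v : ℕ, ((v : ℝ) + 1) * κ (v + 2) := by
  rw [← Literature.Probability.FitznerVanDerHofstad2017.NobleNSums.tsum_sum_antidiagonal
    (summable_antidiag_of_moment h)]
  refine tsum_congr fun v => ?_
  have : ∀ p ∈ antidiagonal v, κ (p.1 + p.2 + 2) = κ (v + 2) := by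
    intro p hp
    rw [mem_antidiagonal.mp hp]
  rw [sum_congr rfl this, sum_const, Nat.card_antidiagonal, nsmul_eq_mul]
  push_cast
  ring

/-- Drop the absolute value inside a first-moment hypothesis: `Σ (t+1)|f t| < ∞ ⇒ Σ (t+1) f t`
converges. -/
theorem summable_weight_mul_of_abs {f : ℕ → ℝ} (h : Summable fun t : ℕ => ((t : ℝ) + 1) * |f t|) :
    Summable fun t : ℕ => ((t : ℝ) + 1) * f t := by
  refine Summable.of_norm (h.congr fun t => ?_)
  rw [norm_mul, Real.norm_eq_abs, Real.norm_eq_abs, abs_of_nonneg (by positivity : (0 : ℝ) ≤ (t : ℝ) + 1)]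

/-! ## The diagonal (Fejér) defect -/

/-- **The Fejér defect of the diagonal part.**  For an even summable `K : ℤ → ℝ` with
`Σ_{t≥0} (t+1)|K(t+1)| < ∞`:
`Σ_{s,t<W} K(t−s) − W·Σ_ℤ K → −2 Σ_{t≥0} (t+1) K(t+1)`. -/
theorem tendsto_diag_sub {K : ℤ → ℝ} (hK : Summable K) (heven : ∀ u, K (-u) = K u)
    (hM : Summable fun t : ℕ => ((t : ℝ) + 1) * |K ((t : ℤ) + 1)|) :
    Tendsto (fun W : ℕ => (∑ s ∈ range W, ∑ t ∈ range W, K ((t : ℤ) - s)) - W * ∑' u, K u) atTop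
      (𝓝 (-2 * ∑' t : ℕ, ((t : ℝ) + 1) * K ((t : ℤ) + 1))) := by
  set κ : ℕ → ℝ := fun t => K ((t : ℤ) + 1) with hκ_def
  have hκ : Summable κ := summable_nat_succ_of_summable_int hK
  have hw : Summable fun t : ℕ => ((t : ℝ) + 1) * κ t := summable_weight_mul_of_abs hM
  -- exact identity at each `W`
  have hid : ∀ W : ℕ, (∑ s ∈ range W, ∑ t ∈ range W, K ((t : ℤ) - s)) - W * ∑' u, K u
      = -2 * ∑ t ∈ range W, ((t : ℝ) + 1) * κ t - 2 * (W * ∑' t, κ (t + W)) := by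
    intro W
    rw [sum_sum_int_sub, tsum_int_eq_zero_add_tsum_nat hK]
    have h2 : ∀ t : ℕ, K ((t : ℤ) + 1) + K (-((t : ℤ) + 1)) = 2 * κ t := fun t => by
      rw [heven, hκ_def]; ring
    simp_rw [h2]
    rw [tsum_mul_left, ← hκ.sum_add_tsum_nat_add W]
    have h3 : ∑ t ∈ range W, ((W : ℝ) - (t + 1)) * (2 * κ t)
        = 2 * (W * ∑ t ∈ range W, κ t) - 2 * ∑ t ∈ range W, ((t : ℝ) + 1) * κ t := by
      rw [mul_sum, mul_sum, mul_sum, ← sum_sub_distrib]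
      exact sum_congr rfl fun t _ => by ring
    rw [h3]
    ring
  simp_rw [hid]
  -- the two limits
  have hA : Tendsto (fun W : ℕ => ∑ t ∈ range W, ((t : ℝ) + 1) * κ t) atTop
      (𝓝 (∑' t : ℕ, ((t : ℝ) + 1) * κ t)) := hw.hasSum.tendsto_sum_nat
  have hB : Tendsto (fun W : ℕ => (W : ℝ) * ∑' t, κ (t + W)) atTop (𝓝 0) := by
    -- `|W Σ_{t} κ(t+W)| ≤ Σ_t (t+W+1)|κ(t+W)| → 0`
    have htail := tendsto_sum_nat_add fun t : ℕ => ((t : ℝ) + 1) * |κ t|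
    refine squeeze_zero_norm (fun W => ?_) htail
    have hs1 : Summable fun t => κ (t + W) := (summable_nat_add_iff W).mpr hκ
    have hs2 : Summable fun t : ℕ => (((t + W : ℕ) : ℝ) + 1) * |κ (t + W)| :=
      (summable_nat_add_iff W).mpr hM
    rw [norm_mul, Real.norm_eq_abs, Nat.abs_cast, Real.norm_eq_abs]
    have habs : |∑' t, κ (t + W)| ≤ ∑' t, |κ (t + W)| := by
      have := norm_tsum_le_tsum_norm hs1.norm
      simpa only [Real.norm_eq_abs] using this
    calc (W : ℝ) * |∑' t, κ (t + W)| ≤ (W : ℝ) * ∑' t, |κ (t + W)| :=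
          mul_le_mul_of_nonneg_left habs (Nat.cast_nonneg W)
      _ = ∑' t, (W : ℝ) * |κ (t + W)| := tsum_mul_left.symm
      _ ≤ ∑' t, (((t + W : ℕ) : ℝ) + 1) * |κ (t + W)| := by
          refine Summable.tsum_le_tsum (fun t => ?_) (hs1.abs.mul_left _) hs2
          have : (W : ℝ) ≤ ((t + W : ℕ) : ℝ) + 1 := by
            push_cast
            linarith [(Nat.cast_nonneg t : (0 : ℝ) ≤ t)]
          exact mul_le_mul_of_nonneg_right this (abs_nonneg _)
  have := (hA.const_mul (-2)).sub (hB.const_mul 2)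
  simpa using this

/-! ## The window constant -/

/-- THE WINDOW CONSTANT `−Σ_{t≥0} (t+2) K(t+1) = −Σ_{u≥1} (u+1) K(u)`, `K = acfConv ρ̄`: the
`W → ∞` limit of `V(W) − 4 τ_int² W` (`tendsto_tauHatAVar_sub_lin`). [ours] -/
def windowConst (ρ : ℕ → ℝ) : ℝ :=
  -∑' t : ℕ, ((t : ℝ) + 2) * acfConv (evenExt ρ) ((t : ℤ) + 1)

/-- **`V(W) − 4 τ_int² W → windowConst ρ`** for a summable normalised `ρ` whose kernel has a first
moment `Σ_{t≥0} (t+1)|K(t+1)| < ∞`. -/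
theorem tendsto_tauHatAVar_sub_lin {ρ : ℕ → ℝ} (hρ : Summable ρ) (h0 : ρ 0 = 1)
    (hM : Summable fun t : ℕ => ((t : ℝ) + 1) * |acfConv (evenExt ρ) ((t : ℤ) + 1)|) :
    Tendsto (fun W : ℕ => tauHatAVar ρ W - 4 * tauInt ρ ^ 2 * W) atTop (𝓝 (windowConst ρ)) := by
  set K : ℤ → ℝ := acfConv (evenExt ρ) with hK_def
  have hK : Summable K := summable_acfConv (summable_evenExt hρ)
  have heven : ∀ u, K (-u) = K u := acfConv_neg _
  -- the exchange part: first-moment hypothesis in the shifted form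
  set κ : ℕ → ℝ := fun n => K n with hκ_def
  have hM2 : Summable fun v : ℕ => ((v : ℝ) + 1) * |κ (v + 2)| := by
    have h1 : Summable fun v : ℕ => (((v + 1 : ℕ) : ℝ) + 1) * |K (((v + 1 : ℕ) : ℤ) + 1)| :=
      (summable_nat_add_iff 1).mpr hM
    refine Summable.of_nonneg_of_le (fun v => by positivity) (fun v => ?_) h1
    have hk : κ (v + 2) = K (((v + 1 : ℕ) : ℤ) + 1) := by
      simp only [hκ_def]
      push_cast
      ring_nf
    rw [hk]
    exact mul_le_mul_of_nonneg_right (by push_cast; linarith) (abs_nonneg _)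
  have hT2 : Tendsto (fun W : ℕ => ∑ s ∈ range W, ∑ t ∈ range W, K ((s + t + 2 : ℕ) : ℤ)) atTop
      (𝓝 (∑' v : ℕ, ((v : ℝ) + 1) * κ (v + 2))) := by
    rw [← tsum_antidiag_eq hM2]
    exact tendsto_sum_range_sum_range (summable_antidiag_of_moment hM2)
  have hT1 := tendsto_diag_sub hK heven hM
  have hsum : ∑' u, K u = 4 * tauInt ρ ^ 2 := tsum_acfConv_evenExt hρ h0
  -- combine
  have hlim := hT1.add hT2
  have hval : -2 * ∑' t : ℕ, ((t : ℝ) + 1) * K ((t : ℤ) + 1) + ∑' v : ℕ, ((v : ℝ) + 1) * κ (v + 2)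
      = windowConst ρ := by
    -- `Σ_v (v+1) κ(v+2) = Σ_t t K(t+1)` (shift; the `t = 0` term vanishes)
    have hw1 : Summable fun t : ℕ => ((t : ℝ) + 1) * K ((t : ℤ) + 1) := summable_weight_mul_of_abs hM
    have hw0 : Summable fun t : ℕ => (t : ℝ) * K ((t : ℤ) + 1) := by
      refine hw1.abs.of_norm_bounded fun t => ?_
      rw [Real.norm_eq_abs, abs_mul, abs_mul, abs_of_nonneg (by positivity : (0 : ℝ) ≤ t),
        abs_of_nonneg (by positivity : (0 : ℝ) ≤ (t : ℝ) + 1)]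
      exact mul_le_mul_of_nonneg_right (by linarith) (abs_nonneg _)
    have hshift : ∑' v : ℕ, ((v : ℝ) + 1) * κ (v + 2) = ∑' t : ℕ, (t : ℝ) * K ((t : ℤ) + 1) := by
      rw [hw0.tsum_eq_zero_add]
      simp only [Nat.cast_zero, zero_mul, zero_add, hκ_def]
      refine tsum_congr fun v => ?_
      push_cast
      ring_nf
    rw [hshift, windowConst, ← hK_def]
    rw [show -2 * ∑' t : ℕ, ((t : ℝ) + 1) * K ((t : ℤ) + 1) + ∑' t : ℕ, (t : ℝ) * K ((t : ℤ) + 1)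
        = -(2 * ∑' t : ℕ, ((t : ℝ) + 1) * K ((t : ℤ) + 1) - ∑' t : ℕ, (t : ℝ) * K ((t : ℤ) + 1)) by ring,
      ← tsum_mul_left, ← (hw1.mul_left 2).tsum_sub hw0]
    congr 1
    refine tsum_congr fun t => ?_
    ring
  rw [← hval]
  refine hlim.congr fun W => ?_
  rw [tauHatAVar_eq_add, hsum]
  ring

/-- **The same for the ratio estimator**: `R(W) − 4 τ_int² W → windowConst ρ + ratioLimit ρ`. -/
theorem tendsto_tauHatRatioAVar_sub_lin {ρ : ℕ → ℝ} (hρ : Summable ρ) (h0 : ρ 0 = 1)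
    (hM : Summable fun t : ℕ => ((t : ℝ) + 1) * |acfConv (evenExt ρ) ((t : ℤ) + 1)|) :
    Tendsto (fun W : ℕ => tauHatRatioAVar ρ W - 4 * tauInt ρ ^ 2 * W) atTop
      (𝓝 (windowConst ρ + ratioLimit ρ)) := by
  have := (tendsto_tauHatAVar_sub_lin hρ h0 hM).add (tendsto_tauHatRatioAVar_sub hρ)
  refine this.congr fun W => ?_
  ring

/-! ## Sign of the window constant for non-negative autocorrelations -/

/-- For `ρ ≥ 0`: `windowConst ρ ≤ −2 Σ_{t≥0} K(t+1) = −(4τ² − K(0))`. -/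
theorem windowConst_le {ρ : ℕ → ℝ} (hρ : Summable ρ) (h0 : ρ 0 = 1) (hnn : ∀ t, 0 ≤ ρ t)
    (hM : Summable fun t : ℕ => ((t : ℝ) + 1) * |acfConv (evenExt ρ) ((t : ℤ) + 1)|) :
    windowConst ρ ≤ -(4 * tauInt ρ ^ 2 - acfConv (evenExt ρ) 0) := by
  set K : ℤ → ℝ := acfConv (evenExt ρ) with hK_def
  have hK : Summable K := summable_acfConv (summable_evenExt hρ)
  have hK0 : ∀ u, 0 ≤ K u := acfConv_nonneg fun m => hnn _
  have hK1 : Summable fun t : ℕ => K ((t : ℤ) + 1) := summable_nat_succ_of_summable_int hK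
  have hw1 : Summable fun t : ℕ => ((t : ℝ) + 1) * K ((t : ℤ) + 1) := summable_weight_mul_of_abs hM
  have hw2 : Summable fun t : ℕ => ((t : ℝ) + 2) * K ((t : ℤ) + 1) :=
    (hw1.add hK1).congr fun t => by ring
  -- `K(0) + 2 Σ K(t+1) = 4τ²`
  have hS : acfConv (evenExt ρ) 0 + 2 * ∑' t : ℕ, K ((t : ℤ) + 1) = 4 * tauInt ρ ^ 2 := by
    rw [← acfConv_zero_add_two_mul_tsum hρ h0]
    have hK' : ∀ t : ℕ, K ((t : ℤ) + 1) = acfConv (evenExt ρ) ((t + 1 : ℕ) : ℤ) := fun t => by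
      rw [hK_def]
      norm_cast
    simp_rw [hK']
  rw [windowConst, ← hK_def, neg_le_neg_iff, show 4 * tauInt ρ ^ 2 - acfConv (evenExt ρ) 0
      = 2 * ∑' t : ℕ, K ((t : ℤ) + 1) by linarith, ← tsum_mul_left]
  exact Summable.tsum_le_tsum (fun t => by nlinarith [hK0 ((t : ℤ) + 1), (Nat.cast_nonneg t : (0 : ℝ) ≤ t)])
    (hK1.mul_left 2) hw2

/-- For `0 ≤ ρ ≤ 1`: `windowConst ρ ≤ −2τ(2τ − 1) ≤ 0` (`K(0) ≤ 2τ`). -/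
theorem windowConst_le' {ρ : ℕ → ℝ} (hρ : Summable ρ) (h0 : ρ 0 = 1) (hnn : ∀ t, 0 ≤ ρ t)
    (hle : ∀ t, ρ t ≤ 1)
    (hM : Summable fun t : ℕ => ((t : ℝ) + 1) * |acfConv (evenExt ρ) ((t : ℤ) + 1)|) :
    windowConst ρ ≤ -(2 * tauInt ρ * (2 * tauInt ρ - 1)) := by
  have h1 := windowConst_le hρ h0 hnn hM
  have h2 := acfConv_zero_le_two_mul_tauInt hρ h0 hnn hle
  nlinarith

/-- Hence, for `0 ≤ ρ ≤ 1` with the first moment: for every `ε > 0`, eventually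
`V(W) < (4W + 2) τ² − (6τ² − 2τ) + ε`, i.e. the printed variance over-covers the known-normalisation
estimator by `6τ² − 2τ − ε` (`> 0` once `τ > ½`), not only by the `2τ²` of `tauHatAVar_lt_printed`. -/
theorem eventually_tauHatAVar_lt_printed_sub {ρ : ℕ → ℝ} (hρ : Summable ρ) (h0 : ρ 0 = 1)
    (hnn : ∀ t, 0 ≤ ρ t) (hle : ∀ t, ρ t ≤ 1)
    (hM : Summable fun t : ℕ => ((t : ℝ) + 1) * |acfConv (evenExt ρ) ((t : ℤ) + 1)|) {ε : ℝ}
    (hε : 0 < ε) :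
    ∀ᶠ W : ℕ in atTop, tauHatAVar ρ W
      < (4 * W + 2) * tauInt ρ ^ 2 - (6 * tauInt ρ ^ 2 - 2 * tauInt ρ) + ε := by
  have hlim := tendsto_tauHatAVar_sub_lin hρ h0 hM
  have hc := windowConst_le' hρ h0 hnn hle hM
  have hev := hlim.eventually (gt_mem_nhds (show windowConst ρ < windowConst ρ + ε by linarith))
  filter_upwards [hev] with W hW
  nlinarith

end Summit.Ventures.LatticeQCDFlow.Scoring
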